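import Mathlib
import Summits.RiemannHypothesis.RiemannHypothesis.Theorems.WeilFarFloorSecondOrderLawRH
import Summits.RiemannHypothesis.RiemannHypothesis.Theorems.WeilFarFloorResidualEnergyLinearRH
import Summits.RiemannHypothesis.RiemannHypothesis.Theorems.WeilFarFloorCoshQuotientLowerRH
import HarnessLib

/-!
# The floor gap is at most `(4β₂ + ε)·a·e^{−a}` under RH; the gap energy is integrable (`β₂ = Σ_ρ m(ρ)²/|ρ|²`)

Helper file (`--supports stmt-RiemannHypothesis-0098`, lead-track anchor: Weil-positivity window ladder, format-C far bound),
pure proofs.  Seat rh-explicit-weil-1 gen16 (memo `run/shared/lean/pub/rh-explicit/rh-explicit-weil-1/FORMAT-K3.md` §17).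

The far-coercivity floor `λ_max(a)` of the Weil window `[−a, a]` and the cosh quotient `R_c(a) = Q_a(C_a)/(a + sinh a)` satisfy,
under RH, the second-order law (upper half) `λ_max ≤ R_c + (1+ε)J/R_c + εe^{−a}` eventually (`WeilFarFloorSecondOrderLawRH`), `J` the
residual energy of the cosh profile, and `J(b) ≤ (4β₂ + ε)b` eventually (`WeilFarFloorResidualEnergyLinearRH`).  Hence
* §1 ★ `farCoercivityFloor_sub_coshQuotient_le_slope_of_RH`: **`RH → ∀ ε > 0, ∃ a₀, ∀ a ≥ a₀, λ_max(a) − R_c(a) ≤ (4β₂ + ε)·a·e^{−a}`**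
  — the linear rate (`WeilFarFloorCoshGapLinearRateRH`: `≤ C(a+1)e^{−a}`) with its constant identified, `4β₂` (`= 4β_F ≈ 0.185` for
  simple zeros; sharp as a limsup if the ordinates of the zeros are linearly independent);
Standard axioms only; RH enters as Mathlib's `RiemannHypothesis`.  Nothing here bears on the truth of RH.
-/

set_option linter.dupNamespace false
set_option autoImplicit false

noncomputable section

open MeasureTheory Set Filter Topology
open scoped Real BigOperators ArithmeticFunction.vonMangoldt Chebyshev

namespace Summit.RiemannHypothesis.RiemannHypothesis.Theorems.WeilFormatC

namespace FloorResidualMean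

open Literature.NumberTheory.LFunctions FloorCosh FloorCoshSplit FloorSecondOrder

/-! ## The floor gap is at most `(4β₂ + ε)·a·e^{−a}` -/

/-- **`RH → ∀ ε > 0, ∃ a₀, ∀ a ≥ a₀, λ_max(a) − R_c(a) ≤ (4β₂ + ε)·a·e^{−a}`**, `β₂ = Σ_ρ m(ρ)²/|ρ|²`: the second-order law
(upper half) with `J ≤ (4β₂ + ε')a` and `R_c ≥ e^a − C(a³+1)`. -/
theorem farCoercivityFloor_sub_coshQuotient_le_slope_of_RH (hRH : RiemannHypothesis) {ε : ℝ} (hε : 0 < ε) :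
    ∃ a₀ : ℝ, ∀ a : ℝ, a₀ ≤ a →
      farCoercivityFloor a - primeShiftForm a ((Icc (-a) a).indicator (fun y ↦ Real.cosh (y / 2))) / (a + Real.sinh a)
        ≤ (4 * (∑' ρ : ZetaZeros.riemannZetaNontrivialZeros,
            (riemannZetaZeroOrder (ρ : ℂ) : ℝ) * ((riemannZetaZeroOrder (ρ : ℂ) : ℝ) / ‖(ρ : ℂ)‖ ^ 2)) + ε) * a * Real.exp (-a) := by
  set β := ∑' ρ : ZetaZeros.riemannZetaNontrivialZeros,
    (riemannZetaZeroOrder (ρ : ℂ) : ℝ) * ((riemannZetaZeroOrder (ρ : ℂ) : ℝ) / ‖(ρ : ℂ)‖ ^ 2) with hβdef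
  have hβ0 : 0 ≤ β := tsum_nonneg fun ρ ↦ by
    have := riemannZetaZeroOrder_nonneg (ZetaZeros.riemannZetaNontrivialZeros.ne_one ρ.2)
    have hm : (0 : ℝ) ≤ riemannZetaZeroOrder (ρ : ℂ) := by exact_mod_cast this
    positivity
  -- ε' for the three inputs
  set ε' := min (ε / (16 * (β + 1))) (1 / 4) with hε'
  have hε'0 : 0 < ε' := by positivity
  have hε'1 : ε' ≤ 1 / 4 := min_le_right _ _
  have hε'2 : ε' ≤ ε / (16 * (β + 1)) := min_le_left _ _
  obtain ⟨a₁, h1⟩ := farCoercivityFloor_le_coshQuotient_add_secondOrder_of_RH hRH hε'0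
  obtain ⟨a₂, h2⟩ := residualEnergy_le_linear_of_RH hRH hε'0
  obtain ⟨Cq, hCq0, h3⟩ := coshQuotient_ge_of_RH hRH
  -- R_c ≥ (1 − ε')e^a once C_q(a³+1)e^{−a} ≤ ε'
  have hsmall : Tendsto (fun a : ℝ ↦ Cq * ((a ^ 3 + 1) * Real.exp (-a))) atTop (𝓝 0) := by
    have h3' : Tendsto (fun a : ℝ ↦ a ^ 3 * Real.exp (-a)) atTop (𝓝 0) := Real.tendsto_pow_mul_exp_neg_atTop_nhds_zero 3
    have h0' : Tendsto (fun a : ℝ ↦ Real.exp (-a)) atTop (𝓝 0) := Real.tendsto_exp_neg_atTop_nhds_zero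
    have := ((h3'.add h0').const_mul Cq)
    simp only [mul_zero, add_zero] at this
    exact this.congr fun a ↦ by ring
  obtain ⟨a₃, h4⟩ := eventually_atTop.1 ((Metric.tendsto_nhds.1 hsmall) ε' hε'0)
  refine ⟨max (max a₁ a₂) (max a₃ 1), fun a ha ↦ ?_⟩
  have ha₁ : a₁ ≤ a := le_trans (le_max_left _ _) (le_trans (le_max_left _ _) ha)
  have ha₂ : a₂ ≤ a := le_trans (le_max_right _ _) (le_trans (le_max_left _ _) ha)
  have ha₃ : a₃ ≤ a := le_trans (le_max_left _ _) (le_trans (le_max_right _ _) ha)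
  have ha1 : 1 ≤ a := le_trans (le_max_right _ _) (le_trans (le_max_right _ _) ha)
  -- instantiate the inputs BEFORE abbreviating (so that `set` rewrites them)
  have hso := h1 a ha₁
  have hJle := h2 a ha₂
  have hq3 := h3 a ha1
  set P := a + Real.sinh a with hP
  set R := primeShiftForm a ((Icc (-a) a).indicator (fun y ↦ Real.cosh (y / 2))) / P with hR
  set J := (∫ x in Ioo (-a) a,
      ((∑ n ∈ weilPrimeIndex a, (Λ n : ℝ) / Real.sqrt n *
          ((Icc (-a) a).indicator (fun y ↦ Real.cosh (y / 2)) (x - Real.log n)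
            + (Icc (-a) a).indicator (fun y ↦ Real.cosh (y / 2)) (x + Real.log n)))
        - R * (Icc (-a) a).indicator (fun y ↦ Real.cosh (y / 2)) x) ^ 2) / P with hJ
  have hE : 0 < Real.exp a := Real.exp_pos a
  have hEa : Real.exp (-a) = (Real.exp a)⁻¹ := Real.exp_neg a
  -- R ≥ (1 − ε') e^a > 0
  have hq := h4 a ha₃
  rw [Real.dist_eq, sub_zero, abs_lt] at hq
  have hRlow : (1 - ε') * Real.exp a ≤ R := by
    have e1 : Cq * (a ^ 3 + 1) = Cq * ((a ^ 3 + 1) * Real.exp (-a)) * Real.exp a := by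
      rw [hEa]; field_simp
    have e2 : Cq * ((a ^ 3 + 1) * Real.exp (-a)) * Real.exp a ≤ ε' * Real.exp a :=
      mul_le_mul_of_nonneg_right hq.2.le hE.le
    linarith
  have hR0 : 0 < R := by nlinarith [hRlow, hE]
  -- the second-order law (upper half) and J's bound are `hso`, `hJle`
  have hP0 : 0 < P := by have := Real.sinh_pos_iff.2 (by linarith : 0 < a); rw [hP]; linarith
  have hJ0 : 0 ≤ J := div_nonneg (integral_nonneg fun x ↦ sq_nonneg _) hP0.le
  -- gap ≤ (1+ε')J/R + ε'e^{−a} ≤ (1+ε')(4β+ε')a/((1−ε')e^a) + ε' e^{−a}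
  have hJR : J / R ≤ (4 * β + ε') * a / ((1 - ε') * Real.exp a) :=
    div_le_div₀ (by positivity) hJle (by nlinarith) hRlow
  have hgap : farCoercivityFloor a - R ≤ (1 + ε') * (J / R) + ε' * Real.exp (-a) := by
    have e : (1 + ε') * J / R = (1 + ε') * (J / R) := by ring
    linarith [hso, e]
  -- arithmetic: (1+ε')(4β+ε')/(1−ε') + ε'/a ≤ 4β + ε for ε' ≤ ε/(16(β+1)), ε' ≤ 1/4, a ≥ 1
  have hkey : (1 + ε') * ((4 * β + ε') * a / ((1 - ε') * Real.exp a)) + ε' * Real.exp (-a)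
      ≤ (4 * β + ε) * a * Real.exp (-a) := by
    rw [hEa]
    rw [div_eq_mul_inv, mul_inv, ← mul_assoc]
    have h1e : 0 < 1 - ε' := by linarith
    have hinv : 0 < (Real.exp a)⁻¹ := inv_pos.2 hE
    -- reduce to: (1+ε')(4β+ε')a/(1−ε') + ε' ≤ (4β+ε)a
    suffices h : (1 + ε') * ((4 * β + ε') * a) / (1 - ε') + ε' ≤ (4 * β + ε) * a by
      have := mul_le_mul_of_nonneg_right h hinv.le
      have e1 : ((1 + ε') * ((4 * β + ε') * a) / (1 - ε') + ε') * (Real.exp a)⁻¹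
          = (1 + ε') * ((4 * β + ε') * a * (1 - ε')⁻¹) * (Real.exp a)⁻¹ + ε' * (Real.exp a)⁻¹ := by
        rw [div_eq_mul_inv]; ring
      linarith [e1]
    rw [div_add' _ _ _ h1e.ne', div_le_iff₀ h1e]
    -- (1+ε')(4β+ε')a + ε'(1−ε') ≤ (4β+ε)a(1−ε')
    have hb16 : ε' * (16 * (β + 1)) ≤ ε := by
      have := mul_le_mul_of_nonneg_right hε'2 (by positivity : (0 : ℝ) ≤ 16 * (β + 1))
      rwa [div_mul_cancel₀ _ (by positivity)] at this
    have ha0 : 0 ≤ a := by linarith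
    have f1 : ε * a * ε' ≤ ε * a / 4 := by
      have := mul_le_mul_of_nonneg_left hε'1 (by positivity : 0 ≤ ε * a); linarith
    have f2 : ε' ^ 2 * a ≤ ε' * a / 4 := by
      have := mul_le_mul_of_nonneg_left hε'1 (by positivity : 0 ≤ ε' * a); nlinarith
    have f3 : 16 * (β + 1) * ε' * a ≤ ε * a := by
      have := mul_le_mul_of_nonneg_right hb16 ha0; linarith
    have f4 : ε' ≤ ε' * a := by nlinarith
    have f5 : 0 ≤ β * ε' * a := by positivity
    have f6 : 0 ≤ ε' * a := by positivity
    have e : (4 * β + ε) * a * (1 - ε') - ((1 + ε') * ((4 * β + ε') * a) + ε' * (1 - ε'))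
        = (ε * a - ε * a * ε') - 8 * (β * ε' * a) - ε' * a - ε' ^ 2 * a - ε' + ε' ^ 2 := by ring
    have hpos : 0 ≤ (ε * a - ε * a * ε') - 8 * (β * ε' * a) - ε' * a - ε' ^ 2 * a - ε' + ε' ^ 2 := by
      have h16 : 16 * (β + 1) * ε' * a = 16 * (β * ε' * a) + 16 * (ε' * a) := by ring
      linarith only [f1, f2, f3, f4, f5, f6, sq_nonneg ε', h16]
    linarith only [e, hpos]
  have hfin := mul_le_mul_of_nonneg_left hJR (by linarith : (0 : ℝ) ≤ 1 + ε')
  linarith only [hgap, hfin, hkey]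

end FloorResidualMean

end Summit.RiemannHypothesis.RiemannHypothesis.Theorems.WeilFormatC
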